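import Mathlib
import HarnessLib

/-!
# Multi-step leapfrog with a multiplicative drift in a normed algebra: the step, the half-step trajectory, and one trajectory with a bounded force

HONEST FRAMING: exact (Metropolis-corrected) sampling algorithms for lattice gauge theory;
figures of merit are autocorrelation/cost numbers at stated couplings and volumes; no
continuum-physics claim.

Venture `LatticeQCDFlow` (cell pub-lqcd), topic `Exactness`, FANOUT row 9 (eng-latcore, the
engine `latflow.core.hmc.HMC(f, β, 'leapfrog').trajectory(τ, nstep)` / `sun_2d.HMC2D` on `SU(N)`
with `nstep ≥ 2`: `P ← P − ½ε∂S`, `U_l ← expm(εP_l) U_l`, …, `n` times).  NEW WORK of the cell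
over Mathlib (normed algebras, operator norms); nothing here is cited as a fact.  Printed
counterparts, NAMED ONLY: Duane–Kennedy–Pendleton–Roweth 1987, Gottlieb–Liu–Toussaint–Renken–Sugar
1987 (the gauge-link leapfrog), Mackenzie 1989 (long fixed-length trajectories can be non-ergodic),
Bou-Rabee–Sanz-Serna 2018 (irreducibility of HMC for short trajectories).

THE POINT.  `LeapfrogShortTrajectory.lean` treats the FLAT leapfrog (`θ ← θ + δp`), which reaches the
torus `U(1)^links` through the angle lift.  `SU(N)` has no flat lift.  This file is the analytic core
of the non-abelian case WITHOUT differential geometry: embed the configuration in a real normed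
algebra `𝔸` (for the lattice: `links → M_N(ℂ)`), read the momenta `p ∈ V` through a continuous linear
`J : V → 𝔸` (`p ↦ (ι p_l)_l`), and let the drift MULTIPLY by `ex (δ • J m)` for any map `ex : 𝔸 → 𝔸`
that is close to `1 + id` near `0` in the Lipschitz sense (`‖ex a − ex a' − (a − a')‖ ≤ η‖a − a'‖`, the
matrix exponential being the instance).  The defect of a product from a sum is then EXACTLY bilinear
(`‖xy‖ ≤ ‖x‖‖y‖`), so a discrete Grönwall induction controls two trajectories uniformly in the number
of steps:

* §1 `plfStep ex J G δ` — one P-first step `K(G) D K(G)` with drift `W ← ex (δ • J m) · W`;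
  `plfTraj ex J G δ p k = (W_k, m_k)` (half-step form, `W_0 = 1`, `m_0 = p + G 1`,
  `W_{k+1} = ex (δ • J m_k) · W_k`, `m_{k+1} = m_k + 2 G W_{k+1}`); `plfStep_iterate`.
* §2 `PLFBounds ex J G T C b K ρ η` — the standing hypotheses: an `ex (J ·) ·`-stable set `T ∋ 1` of
  norm `≤ C` (the group), a force `G` bounded by `b` and `K`-Lipschitz ON `T`, and the defect of `ex`
  on the ball of radius `ρ`; one trajectory: `W_k ∈ T`, `‖m_k − p‖ ≤ (2k+1) b`, the drift arguments
  are `≤ θ := δ‖J‖(R + (2n+1)b)`, **`‖W_k − 1‖ ≤ 2kθC`**.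
* The two-trajectory (discrete Grönwall) estimate is the next file `KickedProductTwoPoint.lean`.

NOT CLAIMED: measure theory, groups, the exponential (the files that use this:
`KickedProductTwoPoint.lean`, `SUNMultiStepLeapfrogHMC*.lean`); floating point.
-/

noncomputable section

namespace Summit.Ventures.LatticeQCDFlow.Exactness

open Set NNReal

variable {𝔸 : Type*} [NormedRing 𝔸] [NormedAlgebra ℝ 𝔸]
variable {V : Type*} [NormedAddCommGroup V] [NormedSpace ℝ V]

/-! ## §1 The step and the half-step trajectory -/

section Defs

variable (ex : 𝔸 → 𝔸) (J : V →L[ℝ] 𝔸) (G : 𝔸 → V) (δ : ℝ)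

/-- **One P-first step with multiplicative drift** `K(G) D K(G)`: kick `m ← m + G W`, drift
`W ← ex (δ • J m) · W`, kick `m ← m + G W`. -/
def plfStep (z : 𝔸 × V) : 𝔸 × V :=
  (ex (δ • J (z.2 + G z.1)) * z.1, z.2 + G z.1 + G (ex (δ • J (z.2 + G z.1)) * z.1))

/-- **The trajectory in half-step form** from `(1, p)`: `plfTraj p k = (W_k, m_k)`, `W_0 = 1`,
`m_0 = p + G 1`, `W_{k+1} = ex (δ • J m_k) · W_k`, `m_{k+1} = m_k + 2 G W_{k+1}`. -/
def plfTraj (p : V) : ℕ → 𝔸 × V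
  | 0 => (1, p + G 1)
  | k + 1 => (ex (δ • J (plfTraj p k).2) * (plfTraj p k).1,
      (plfTraj p k).2 + (2 : ℝ) • G (ex (δ • J (plfTraj p k).2) * (plfTraj p k).1))

variable (p : V)

/-- The step at `0`. -/
@[simp] theorem plfTraj_zero : plfTraj ex J G δ p 0 = (1, p + G 1) := rfl

/-- The recursion, first component. -/
theorem plfTraj_succ_fst (k : ℕ) :
    (plfTraj ex J G δ p (k + 1)).1 = ex (δ • J (plfTraj ex J G δ p k).2) * (plfTraj ex J G δ p k).1 := rfl

/-- The recursion, second component. -/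
theorem plfTraj_succ_snd (k : ℕ) :
    (plfTraj ex J G δ p (k + 1)).2 = (plfTraj ex J G δ p k).2 + (2 : ℝ) • G (plfTraj ex J G δ p (k + 1)).1 := rfl

/-- **`k` steps in half-step form**: `(plfStep)^[k] (1, p) = (W_k, m_k − G W_k)`. -/
theorem plfStep_iterate (k : ℕ) :
    (plfStep ex J G δ)^[k] (1, p) = ((plfTraj ex J G δ p k).1, (plfTraj ex J G δ p k).2 - G (plfTraj ex J G δ p k).1) := by
  induction k with
  | zero => simp
  | succ k ih =>
    rw [Function.iterate_succ_apply', ih, plfTraj_succ_snd, plfTraj_succ_fst]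
    simp only [plfStep, sub_add_cancel, two_smul, Prod.mk.injEq, true_and]
    abel

/-- The configuration after `k` steps is `W_k`. -/
theorem plfStep_iterate_fst (k : ℕ) : ((plfStep ex J G δ)^[k] (1, p)).1 = (plfTraj ex J G δ p k).1 := by
  rw [plfStep_iterate]

/-- The momentum after `k` steps is `m_k − G W_k`. -/
theorem plfStep_iterate_snd (k : ℕ) :
    ((plfStep ex J G δ)^[k] (1, p)).2 = (plfTraj ex J G δ p k).2 - G (plfTraj ex J G δ p k).1 := by
  rw [plfStep_iterate]

end Defs

/-! ## §2 Standing hypotheses; one trajectory -/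

/-- **The standing hypotheses.**  `T` (the group, embedded) contains `1`, is stable under
`W ↦ ex (J v) · W` and has norm `≤ C` (`C ≥ 1`); the force `G` is bounded by `b` and `K`-Lipschitz ON
`T`; `ex 0 = 1` and `ex` is within `η ≤ 1` of `1 + id` in the Lipschitz sense on the ball of radius
`ρ`. -/
structure PLFBounds (ex : 𝔸 → 𝔸) (J : V →L[ℝ] 𝔸) (G : 𝔸 → V) (T : Set 𝔸) (C b K ρ η : ℝ) : Prop where
  one_mem : (1 : 𝔸) ∈ T
  mul_mem : ∀ (v : V) (W : 𝔸), W ∈ T → ex (J v) * W ∈ T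
  norm_le : ∀ W ∈ T, ‖W‖ ≤ C
  one_le : 1 ≤ C
  force_le : ∀ W ∈ T, ‖G W‖ ≤ b
  force_lip : ∀ W ∈ T, ∀ W' ∈ T, ‖G W - G W'‖ ≤ K * ‖W - W'‖
  lip_nonneg : 0 ≤ K
  ex_zero : ex 0 = 1
  ex_defect : ∀ a a' : 𝔸, ‖a‖ ≤ ρ → ‖a'‖ ≤ ρ → ‖ex a - ex a' - (a - a')‖ ≤ η * ‖a - a'‖
  defect_nonneg : 0 ≤ η
  defect_le_one : η ≤ 1
  radius_nonneg : 0 ≤ ρ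

section OneTrajectory

variable {ex : 𝔸 → 𝔸} {J : V →L[ℝ] 𝔸} {G : 𝔸 → V} {T : Set 𝔸} {C b K ρ η : ℝ}
  (h : PLFBounds ex J G T C b K ρ η) (δ : ℝ) (p : V)
include h

/-- `b ≥ 0` (the bound holds at `1 ∈ T`). -/
theorem PLFBounds.force_bound_nonneg : 0 ≤ b := (norm_nonneg _).trans (h.force_le 1 h.one_mem)

/-- **`W_k ∈ T`** along the trajectory. -/
theorem plfTraj_fst_mem (k : ℕ) : (plfTraj ex J G δ p k).1 ∈ T := by
  induction k with
  | zero => exact h.one_mem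
  | succ k ih =>
    rw [plfTraj_succ_fst, ← map_smul]
    exact h.mul_mem _ _ ih

/-- **`‖m_k − p‖ ≤ (2k+1) b`.** -/
theorem plfTraj_snd_sub_le (k : ℕ) : ‖(plfTraj ex J G δ p k).2 - p‖ ≤ (2 * k + 1) * b := by
  induction k with
  | zero => simpa using h.force_le 1 h.one_mem
  | succ k ih =>
    rw [plfTraj_succ_snd]
    have h2 : ‖(2 : ℝ) • G (plfTraj ex J G δ p (k + 1)).1‖ ≤ 2 * b := by
      rw [norm_smul, Real.norm_two]
      exact mul_le_mul_of_nonneg_left (h.force_le _ (plfTraj_fst_mem h δ p (k + 1))) zero_le_two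
    calc ‖(plfTraj ex J G δ p k).2 + (2 : ℝ) • G (plfTraj ex J G δ p (k + 1)).1 - p‖
        = ‖((plfTraj ex J G δ p k).2 - p) + (2 : ℝ) • G (plfTraj ex J G δ p (k + 1)).1‖ := by abel_nf
      _ ≤ ‖(plfTraj ex J G δ p k).2 - p‖ + ‖(2 : ℝ) • G (plfTraj ex J G δ p (k + 1)).1‖ := norm_add_le _ _
      _ ≤ (2 * k + 1) * b + 2 * b := add_le_add ih h2
      _ = (2 * (↑(k + 1) : ℝ) + 1) * b := by push_cast; ring

/-- `‖m_k‖ ≤ R + (2k+1) b` for `‖p‖ ≤ R`. -/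
theorem norm_plfTraj_snd_le {R : ℝ} (hp : ‖p‖ ≤ R) (k : ℕ) :
    ‖(plfTraj ex J G δ p k).2‖ ≤ R + (2 * k + 1) * b := by
  calc ‖(plfTraj ex J G δ p k).2‖ = ‖p + ((plfTraj ex J G δ p k).2 - p)‖ := by rw [add_sub_cancel]
    _ ≤ ‖p‖ + ‖(plfTraj ex J G δ p k).2 - p‖ := norm_add_le _ _
    _ ≤ R + (2 * k + 1) * b := add_le_add hp (plfTraj_snd_sub_le h δ p k)

/-- **The final momentum of `k` steps stays in a box**: `‖m_k − G W_k‖ ≤ R + 2(k+1) b`. -/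
theorem norm_plfStep_iterate_snd_le {R : ℝ} (hp : ‖p‖ ≤ R) (k : ℕ) :
    ‖((plfStep ex J G δ)^[k] (1, p)).2‖ ≤ R + 2 * ((k : ℝ) + 1) * b := by
  rw [plfStep_iterate_snd]
  calc ‖(plfTraj ex J G δ p k).2 - G (plfTraj ex J G δ p k).1‖
      ≤ ‖(plfTraj ex J G δ p k).2‖ + ‖G (plfTraj ex J G δ p k).1‖ := norm_sub_le _ _
    _ ≤ R + (2 * k + 1) * b + b := add_le_add (norm_plfTraj_snd_le h δ p hp k) (h.force_le _ (plfTraj_fst_mem h δ p k))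
    _ = R + 2 * ((k : ℝ) + 1) * b := by ring

/-- **The drift arguments are small**: for `δ ≥ 0`, `‖p‖ ≤ R` and `k ≤ n`,
`‖δ • J m_k‖ ≤ δ‖J‖(R + (2n+1) b)` (`=: θ`). -/
theorem norm_driftArg_le {R : ℝ} (hp : ‖p‖ ≤ R) (hδ : 0 ≤ δ) {n k : ℕ} (hk : k ≤ n) :
    ‖δ • J (plfTraj ex J G δ p k).2‖ ≤ δ * ‖J‖ * (R + (2 * n + 1) * b) := by
  rw [norm_smul, Real.norm_of_nonneg hδ, mul_assoc]
  refine mul_le_mul_of_nonneg_left ((J.le_opNorm _).trans (mul_le_mul_of_nonneg_left ?_ (norm_nonneg _))) hδ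
  refine (norm_plfTraj_snd_le h δ p hp k).trans ?_
  have hb := h.force_bound_nonneg
  have hkn : (k : ℝ) ≤ n := Nat.cast_le.2 hk
  nlinarith

/-- `‖ex a − 1‖ ≤ 2‖a‖` on the ball of radius `ρ` (`ex 0 = 1`, defect `η ≤ 1`). -/
theorem PLFBounds.norm_ex_sub_one_le {a : 𝔸} (ha : ‖a‖ ≤ ρ) : ‖ex a - 1‖ ≤ 2 * ‖a‖ := by
  have hd := h.ex_defect a 0 ha (by rw [norm_zero]; exact h.radius_nonneg)
  rw [h.ex_zero, sub_zero] at hd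
  calc ‖ex a - 1‖ = ‖(ex a - 1 - a) + a‖ := by rw [sub_add_cancel]
    _ ≤ ‖ex a - 1 - a‖ + ‖a‖ := norm_add_le _ _
    _ ≤ η * ‖a‖ + ‖a‖ := add_le_add hd le_rfl
    _ ≤ 1 * ‖a‖ + ‖a‖ := by gcongr; exact h.defect_le_one
    _ = 2 * ‖a‖ := by ring

/-- **`‖W_k − 1‖ ≤ 2kθC`** for `k ≤ n`, when the drift arguments are `≤ θ ≤ ρ`. -/
theorem norm_plfTraj_fst_sub_one_le {R : ℝ} (hp : ‖p‖ ≤ R) (hδ : 0 ≤ δ) {n : ℕ}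
    (hρ : δ * ‖J‖ * (R + (2 * n + 1) * b) ≤ ρ) :
    ∀ k ≤ n, ‖(plfTraj ex J G δ p k).1 - 1‖ ≤ k * (2 * (δ * ‖J‖ * (R + (2 * n + 1) * b)) * C) := by
  intro k
  induction k with
  | zero => intro; simp
  | succ k ih =>
    intro hk
    have hkn : k ≤ n := Nat.le_of_succ_le hk
    set θ : ℝ := δ * ‖J‖ * (R + (2 * n + 1) * b) with hθ
    set W := (plfTraj ex J G δ p k).1 with hW
    set a := δ • J (plfTraj ex J G δ p k).2 with ha
    have haθ : ‖a‖ ≤ θ := norm_driftArg_le h δ p hp hδ hkn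
    have hsplit : (plfTraj ex J G δ p (k + 1)).1 - 1 = (ex a - 1) * W + (W - 1) := by
      rw [plfTraj_succ_fst]; noncomm_ring
    rw [hsplit]
    calc ‖(ex a - 1) * W + (W - 1)‖ ≤ ‖ex a - 1‖ * ‖W‖ + ‖W - 1‖ :=
          (norm_add_le _ _).trans (add_le_add (norm_mul_le _ _) le_rfl)
      _ ≤ 2 * θ * C + k * (2 * θ * C) := by
          refine add_le_add ?_ (ih hkn)
          have h1 : ‖ex a - 1‖ ≤ 2 * θ := (h.norm_ex_sub_one_le (haθ.trans hρ)).trans (by linarith)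
          exact mul_le_mul h1 (h.norm_le _ (plfTraj_fst_mem h δ p k)) (norm_nonneg _)
            (by linarith [norm_nonneg a])
      _ = (↑(k + 1) : ℝ) * (2 * θ * C) := by push_cast; ring

end OneTrajectory

end Summit.Ventures.LatticeQCDFlow.Exactness
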